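import Literature.AlgebraicGeometry.Resolution.HenselizedFunctionFieldsImmediate
import Literature.AlgebraicGeometry.Resolution.GeneralizedStabilityRankOneVT
import Literature.AlgebraicGeometry.Resolution.ValuationIndependence
import Literature.AlgebraicGeometry.Resolution.HenselizationImmediateProofs
import HarnessLib

/-!
# Valued extensions of `K(x)`, `x` residue-transcendental over an algebraically closed `K` (Kuhlmann 2010, §2.1, §2.5, §5)

Topic: `Literature/AlgebraicGeometry/Resolution` (valued function fields). PROVED valuation-
theoretic glue for the proof of Lemma 5.5 (Case II) of F.-V. Kuhlmann, *Elimination of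
ramification I*, Trans. AMS 362 (2010) = arXiv:1003.5678 — "Since `vK(x) = vK` is divisible and
`vF/vK(x)` is finite, we have `vF = vK(x)`. Since `F̄|K(x)‾` is finite and `K(x)‾ = K̄(x̄)` is a
function field of transcendence degree `1` over `K̄`, the same holds for `F̄`" — in the ambient
rendering (`(Ω, V)` valued field, subfields of `Ω`; `IsResidueTranscendental`,
`GeneralizedStabilityRankOneHenselized.lean`; the class `IsHenselizedInertiallyGeneratedRT`,
`HenselizedFunctionFields.lean`):

* `valueSubgroup_adjoin_eq_of_isResidueTranscendental`,
  `residueSubfield_adjoin_eq_of_isResidueTranscendental` — **Lemma 2.5 for `K(x)`, `x`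
  residue-transcendental (the Gauss valuation)**: `vK(x) = vK` and `K(x)v = Kv(x̄)`, from the
  ambient Lemma 2.5 of `ValuationIndependence.lean`.
* `exists_pow_eq_of_mem_valueSubgroup` — `vK` is divisible for `K` algebraically closed
  (Lemma 2.1); `valueSubgroup_eq_of_algebraic_of_divisible` — an algebraic extension whose base
  has a divisible value group has the same value group (Lemma 2.1: `vL/vK` is a torsion group).
* `isRankOne_of_isRankOneValued` — the archimedean rendering `IsRankOneValued`
  (`GeneralizedStabilityHenselizedRational.lean`) implies the overring rendering `IsRankOne`
  (`HenselizedFunctionFields.lean`) of "rank 1" (§2.1), converse to `isRankOneValued_of_overrings`.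
* `IsHenselizedInertiallyGeneratedRT.valueSubgroup_eq` (`vF = vK`),
  `IsHenselizedInertiallyGeneratedRT.isRankOneValued` — for fields of the class over an
  algebraically closed `K`, and for their finite extensions.

## Sources

* F.-V. Kuhlmann, loc. cit.: §2.1 (Lemma 2.1, Lemma 2.5, rank), §2.5, §5 (proof of Lemma 5.5,
  p. 19). [folklore] where so marked.
-/

noncomputable section

open IsLocalRing

namespace Literature.AlgebraicGeometry.Resolution

universe u

variable {Ω : Type u} [Field Ω] (V : ValuationSubring Ω)

/-! ### Lemma 2.5 for `K(x)`, `x` residue-transcendental -/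

section Gauss

variable {K : Subfield Ω} {x : Ω}

/-- The hypotheses of the ambient Lemma 2.5 (`ValuationIndependence.lean`) for the system
`x = ∅`, `y = (x)` with `x` residue-transcendental. [folklore] -/
theorem algebraicIndependent_residue_of_isResidueTranscendental (hx : IsResidueTranscendental V K x) :
    AlgebraicIndependent (resField V K) (fun _ : Fin 1 => residue V ⟨x, hx.mem⟩) := by
  rw [algebraicIndependent_unique_type_iff]
  exact hx.2

/-- `K(x)` is the subfield generated by `K` and `x` (with the empty family of `x`'s and the
one-element family of `y`'s of `ValuationIndependence.lean`). [folklore] -/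
theorem mem_closure_of_mem_adjoin {a : Ω}
    (ha : a ∈ (IntermediateField.adjoin K ({x} : Set Ω)).toSubfield) :
    a ∈ Subfield.closure ((K : Set Ω) ∪
      (Set.range (Fin.elim0 : Fin 0 → Ω) ∪ Set.range (fun _ : Fin 1 => x))) := by
  rw [Set.range_eq_empty (Fin.elim0 : Fin 0 → Ω), Set.empty_union, Set.range_const]
  exact (mem_adjoin_subfield_iff K {x} a).mp ha

/-- **Kuhlmann 2010, Lemma 2.5 for `K(x)`, `x` residue-transcendental: `vK(x) = vK`** ("the value
of the polynomial `f` is equal to the least of the values of its monomials. In particular, …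
`vK(xᵢ, yⱼ | i ∈ I, j ∈ J) = vK ⊕ ⊕ᵢ ℤvxᵢ`" with `I = ∅`). PROVED from the ambient Lemma 2.5
(`exists_valuation_eq_of_mem_closure`). [cite: Kuhlmann2010, Lemma 2.5] -/
theorem valueSubgroup_adjoin_eq_of_isResidueTranscendental (hx : IsResidueTranscendental V K x) :
    valueSubgroup (IntermediateField.adjoin K ({x} : Set Ω)).toSubfield V = valueSubgroup K V := by
  classical
  refine le_antisymm (fun γ hγ => ?_)
    (valueSubgroup_subfield_mono (subfield_le_toSubfield _))
  obtain ⟨c, hc0, hγc⟩ := (mem_valueSubgroup_iff _ V γ).mp hγ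
  have hc0' : (c : Ω) ≠ 0 := fun h => hc0 (Subtype.ext h)
  obtain ⟨m, b, hbK, hb⟩ := exists_valuation_eq_of_mem_closure V K (x := (Fin.elim0 : Fin 0 → Ω))
    (y := fun _ : Fin 1 => x) (fun i => Fin.elim0 i) (fun m _ => funext fun i => Fin.elim0 i)
    (fun _ => hx.mem) (algebraicIndependent_residue_of_isResidueTranscendental V hx)
    (mem_closure_of_mem_adjoin c.2) hc0'
  rw [Finset.univ_eq_empty, Finset.prod_empty, mul_one] at hb
  refine (mem_valueSubgroup_iff K V γ).mpr ⟨⟨b, hbK⟩, ?_, ?_⟩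
  · intro hb0
    have : b = 0 := congrArg Subtype.val hb0
    rw [this, map_zero, map_eq_zero] at hb
    exact hc0' hb
  · rw [hγc]
    exact hb

/-- **Kuhlmann 2010, Lemma 2.5 for `K(x)`, `x` residue-transcendental: `K(x)v = Kv(x̄)`**
("`K(xᵢ, yⱼ | i ∈ I, j ∈ J)v = Kv(yⱼv | j ∈ J)`"). PROVED from the ambient Lemma 2.5
(`residue_mem_closure_of_mem_closure`). [cite: Kuhlmann2010, Lemma 2.5] -/
theorem residueSubfield_adjoin_eq_of_isResidueTranscendental (hx : IsResidueTranscendental V K x) :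
    residueSubfield (IntermediateField.adjoin K ({x} : Set Ω)).toSubfield V =
      Subfield.closure ((residueSubfield K V : Set (ResidueField V)) ∪ {residue V ⟨x, hx.mem⟩}) := by
  classical
  apply le_antisymm
  · intro r hr
    rw [residueSubfield_subfield_eq_resField] at hr
    obtain ⟨a, ha, rfl⟩ := (mem_resField_iff V _ _).mp hr
    have h := residue_mem_closure_of_mem_closure V K (x := (Fin.elim0 : Fin 0 → Ω))
      (y := fun _ : Fin 1 => x) (fun i => Fin.elim0 i) (fun m _ => funext fun i => Fin.elim0 i)
      (fun _ => hx.mem) (algebraicIndependent_residue_of_isResidueTranscendental V hx)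
      (mem_closure_of_mem_adjoin ha) a.2
    rw [Set.range_const, residueSubfield_subfield_eq_resField] at *
    exact h
  · rw [Subfield.closure_le]
    rintro r (hr | hr)
    · exact residueSubfield_subfield_mono (subfield_le_toSubfield _) hr
    · rw [Set.mem_singleton_iff] at hr
      subst hr
      rw [residueSubfield_subfield_eq_resField]
      exact residue_mem_resField V ⟨x, hx.mem⟩
        (IntermediateField.subset_adjoin K ({x} : Set Ω) rfl)

end Gauss

/-! ### Divisible value groups; value groups of algebraic extensions -/

section Divisible

/-- **`vK` is divisible for `K` algebraically closed** (Kuhlmann 2010, Lemma 2.1: "the value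
group of `K̃` is divisible"): every value of `K^×` has an `n`-th root among the values of `K^×`
(take an `n`-th root of the element). [cite: Kuhlmann2010, Lemma 2.1] -/
theorem exists_pow_eq_of_mem_valueSubgroup {K : Subfield Ω} (hK : IsAlgClosed K)
    {γ : (V.ValueGroup)ˣ} (hγ : γ ∈ valueSubgroup K V) {n : ℕ} (hn : n ≠ 0) :
    ∃ δ ∈ valueSubgroup K V, δ ^ n = γ := by
  haveI := hK
  obtain ⟨c, hc0, hγc⟩ := (mem_valueSubgroup_iff K V γ).mp hγ
  obtain ⟨d, hd⟩ := IsAlgClosed.exists_pow_nat_eq c (Nat.pos_of_ne_zero hn)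
  have hd0 : d ≠ 0 := by
    rintro rfl
    rw [zero_pow hn] at hd
    exact hc0 hd.symm
  have hvd : V.valuation (d : Ω) ≠ 0 := (map_ne_zero _).mpr fun h => hd0 (Subtype.ext h)
  refine ⟨Units.mk0 _ hvd, (mem_valueSubgroup_iff K V _).mpr ⟨d, hd0, rfl⟩, Units.ext ?_⟩
  rw [Units.val_pow_eq_pow_val, Units.val_mk0, hγc, ← map_pow]
  congr 1
  exact congrArg Subtype.val hd

/-- **An algebraic extension of a field with divisible value group has the same value group**
(Kuhlmann 2010, Lemma 2.1: "`vL/vK` is a torsion group" — so `vL ⊆` the divisible hull of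
`vK`, which is `vK`): for `K' ≤ E` inside `(Ω, V)` with every element of `E` algebraic over `K'`
and `vK'` divisible, `vE = vK'`. PROVED (`exists_valuation_pow_eq_of_isAlgebraic`, and value
groups are torsion free). [cite: Kuhlmann2010, Lemma 2.1] -/
theorem valueSubgroup_eq_of_algebraic_of_divisible {K' E : Subfield Ω} (hle : K' ≤ E)
    (halg : ∀ a ∈ E, IsAlgebraic K' a)
    (hdiv : ∀ γ ∈ valueSubgroup K' V, ∀ n : ℕ, n ≠ 0 → ∃ δ ∈ valueSubgroup K' V, δ ^ n = γ) :
    valueSubgroup E V = valueSubgroup K' V := by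
  refine le_antisymm (fun γ hγ => ?_) (valueSubgroup_subfield_mono hle)
  obtain ⟨a, ha0, hγa⟩ := (mem_valueSubgroup_iff E V γ).mp hγ
  have ha0' : (a : Ω) ≠ 0 := fun h => ha0 (Subtype.ext h)
  obtain ⟨n, hn, b, hbK', hnb⟩ := exists_valuation_pow_eq_of_isAlgebraic V (halg a a.2) ha0'
  rw [map_pow] at hnb
  have hb0 : b ≠ 0 := by
    rintro rfl
    rw [map_zero, pow_eq_zero_iff hn, map_eq_zero] at hnb
    exact ha0' hnb
  have hvb : V.valuation b ≠ 0 := (map_ne_zero _).mpr hb0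
  have hbmem : Units.mk0 _ hvb ∈ valueSubgroup K' V :=
    (mem_valueSubgroup_iff K' V _).mpr ⟨⟨b, hbK'⟩, fun h => hb0 (congrArg Subtype.val h), rfl⟩
  obtain ⟨δ, hδ, hδn⟩ := hdiv _ hbmem n hn
  obtain ⟨c, hc0, hδc⟩ := (mem_valueSubgroup_iff K' V δ).mp hδ
  -- `v(a)^n = v(b) = v(c)^n`, so `v(a) = v(c)`
  have h1 : V.valuation (a : Ω) ^ n = V.valuation (algebraMap K' Ω c) ^ n := by
    rw [← hδc, ← Units.val_pow_eq_pow_val, hδn, Units.val_mk0, hnb]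
  have h2 : V.valuation (a : Ω) = V.valuation (algebraMap K' Ω c) := valuation_eq_of_pow_eq V hn h1
  rw [(mem_valueSubgroup_iff K' V γ)]
  exact ⟨c, hc0, hγa.trans h2⟩

end Divisible

/-! ### Rank one: archimedean form ⇒ overring form -/

section RankOne

/-- **Archimedean value group ⇒ only two overrings** (Kuhlmann 2010, §2.1: "It has rank 1
(i.e., its only convex subgroups are `{0}` and `vK`) if and only if `vK` is archimedean"), the
converse of `isRankOneValued_of_overrings`: if some element of `M` has value `> 1` and the
values of `M` are archimedean, then `V ∩ M ≠ M` and an overring `S ⊋ V ∩ M` is all of `M` (an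
element `s ∈ S` of value `> 1` absorbs every `b`: `v(b) ≤ v(s)^n`, so `b/s^n ∈ V ∩ M ⊆ S`).
PROVED. [cite: Kuhlmann2010, Section 2.1] -/
theorem isRankOne_of_isRankOneValued {M : Subfield Ω} (h : IsRankOneValued V M) : IsRankOne V M := by
  obtain ⟨⟨a, haM, hva⟩, harch⟩ := h
  refine ⟨fun htop => ?_, fun S hS => ?_⟩
  · have haO : (⟨a, haM⟩ : M) ∈ V.comap (algebraMap M Ω) := by
      rw [htop]
      exact ValuationSubring.mem_top _
    exact not_le.mpr hva ((V.valuation_le_one_iff _).mpr haO)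
  · by_cases hSO : S = V.comap (algebraMap M Ω)
    · exact Or.inl hSO
    · right
      -- an element of `S` outside `V ∩ M`
      obtain ⟨s, hsS, hsO⟩ : ∃ s : M, s ∈ S ∧ s ∉ V.comap (algebraMap M Ω) := by
        by_contra hcon
        push Not at hcon
        exact hSO (le_antisymm (fun s hs => hcon s hs) hS)
      have hvs : 1 < V.valuation (s : Ω) :=
        not_le.mp fun hle => hsO ((V.valuation_le_one_iff _).mp hle)
      have hs0 : (s : Ω) ≠ 0 := by
        intro h0
        rw [h0, map_zero] at hvs
        exact not_lt_zero hvs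
      refine eq_top_iff.mpr fun b _ => ?_
      obtain ⟨n, hn⟩ := harch s s.2 b b.2 hvs
      -- `b / s^n ∈ V ∩ M ⊆ S`
      have hq : b / s ^ n ∈ V.comap (algebraMap M Ω) := by
        change ((b / s ^ n : M) : Ω) ∈ V
        rw [← V.valuation_le_one_iff]
        push_cast
        rw [map_div₀, map_pow]
        exact div_le_one_of_le₀ hn zero_le
      have hsn : s ^ n ∈ S := S.pow_mem hsS n
      have hsn0 : (s : M) ^ n ≠ 0 := pow_ne_zero n fun h => hs0 (congrArg Subtype.val h)
      have : b = b / s ^ n * s ^ n := (div_mul_cancel₀ b hsn0).symm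
      rw [this]
      exact S.mul_mem _ _ (hS hq) hsn

end RankOne

/-! ### Fields of the class: value group and rank -/

section Class

variable {V}
variable {K F : Subfield Ω}

/-- **`vF = vK` for a field `F` of the class over an algebraically closed `K`** (Kuhlmann 2010,
§2.5: "`vF = vK` is divisible … in the residue-transcendental case"): `vK(x) = vK` (Lemma 2.5),
`vK(x)^h = vK(x)` (Lemma 2.2, `Kuhlmann2010HenselizationImmediate_holds`), `vF = vK(x)^h`
(unramified). PROVED. [cite: Kuhlmann2010, Section 2.5] -/
theorem IsHenselizedInertiallyGeneratedRT.valueSubgroup_eq [IsAlgClosed Ω]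
    (hF : IsHenselizedInertiallyGeneratedRT V K F) : valueSubgroup F V = valueSubgroup K V := by
  obtain ⟨x, hx, -, hunr⟩ := hF
  obtain ⟨-, -, -, -, hv⟩ := hunr
  rw [hv, (IsImmediateOver.valueSubgroup_eq_and_residueSubfield_eq V (le_henselization V _)
      (Kuhlmann2010HenselizationImmediate_holds Ω V _)).1,
    valueSubgroup_adjoin_eq_of_isResidueTranscendental V hx]

/-- **`vE = vK` for a finite (indeed algebraic) extension `E` of a field of the class** over an
algebraically closed `K` ("Since `vK(x) = vK` is divisible and `vF/vK(x)` is finite, we have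
`vF = vK(x)`", proof of Lemma 5.5). PROVED. [cite: Kuhlmann2010, Lemma 5.5 (proof, Case II)] -/
theorem IsHenselizedInertiallyGeneratedRT.valueSubgroup_eq_of_algebraic [IsAlgClosed Ω] (hK : IsAlgClosed K)
    (hF : IsHenselizedInertiallyGeneratedRT V K F) {E : Subfield Ω} (hle : F ≤ E)
    (halg : ∀ a ∈ E, IsAlgebraic F a) : valueSubgroup E V = valueSubgroup K V := by
  have hvF := hF.valueSubgroup_eq
  rw [← hvF]
  refine valueSubgroup_eq_of_algebraic_of_divisible V hle halg fun γ hγ n hn => ?_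
  rw [hvF] at hγ ⊢
  exact exists_pow_eq_of_mem_valueSubgroup V hK hγ hn

/-- A field of the class has an element of `K` of value `> 1` (the valuation is non-trivial on
`K(x)`, and `vK(x) = vK`). [folklore] -/
theorem IsHenselizedInertiallyGeneratedRT.exists_one_lt_valuation
    (hF : IsHenselizedInertiallyGeneratedRT V K F) : ∃ a ∈ K, 1 < V.valuation a := by
  obtain ⟨x, hx, hr, -⟩ := hF
  obtain ⟨⟨a, ha, hva⟩, -⟩ := isRankOneValued_of_overrings V _ hr.1 hr.2
  have ha0 : V.valuation a ≠ 0 := by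
    intro h
    rw [h] at hva
    exact not_lt_zero hva
  have hmem : Units.mk0 _ ha0 ∈ valueSubgroup (IntermediateField.adjoin K ({x} : Set Ω)).toSubfield V :=
    (mem_valueSubgroup_iff _ V _).mpr ⟨⟨a, ha⟩, fun h => by
      have : a = 0 := congrArg Subtype.val h
      rw [this, map_zero] at hva
      exact not_lt_zero hva, rfl⟩
  rw [valueSubgroup_adjoin_eq_of_isResidueTranscendental V hx] at hmem
  obtain ⟨c, -, hc⟩ := (mem_valueSubgroup_iff K V _).mp hmem
  refine ⟨c, c.2, ?_⟩
  rw [Units.val_mk0] at hc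
  exact hc ▸ hva

/-- **Fields of the class, and their algebraic extensions, have rank one in the archimedean
form** (`IsRankOneValued`; §2.1 and Lemma 2.1: `K(x)` has rank one and everything is algebraic
over `K(x)`). PROVED. [cite: Kuhlmann2010, Section 2.1] -/
theorem IsHenselizedInertiallyGeneratedRT.isRankOneValued_of_algebraic
    (hF : IsHenselizedInertiallyGeneratedRT V K F) {E : Subfield Ω} (hle : F ≤ E)
    (halg : ∀ a ∈ E, IsAlgebraic F a) : IsRankOneValued V E := by
  obtain ⟨x, hx, hr, hunr⟩ := id hF
  have h1 : IsRankOneValued V (IntermediateField.adjoin K ({x} : Set Ω)).toSubfield :=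
    isRankOneValued_of_overrings V _ hr.1 hr.2
  -- everything in `E` is algebraic over `K(x)`
  have hKxF : (IntermediateField.adjoin K ({x} : Set Ω)).toSubfield ≤ F :=
    (le_henselization V _).trans hunr.le
  refine h1.of_algebraic V (hKxF.trans hle) fun a ha => ?_
  have hFalg : ∀ w ∈ F, IsAlgebraic (IntermediateField.adjoin K ({x} : Set Ω)).toSubfield w := by
    intro w hw
    refine isAlgebraic_trans_subfield (le_henselization V _) (fun u hu => ?_)
      (isAlgebraic_of_relfinrank_pos hunr.le hunr.relfinrank_pos hw)
    exact (isSeparable_of_mem_henselization V _ hu).isIntegral.isAlgebraic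
  exact isAlgebraic_trans_subfield hKxF hFalg (halg a ha)

end Class

end Literature.AlgebraicGeometry.Resolution
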